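import Summits.QuantumFields.BalabanUV.Beta.GAN24.OneStepConstraintAxialLocalisation
import Summits.QuantumFields.BalabanUV.Beta.GAN24.VolumeLimitPairsRect

/-!
# `BalabanUV.Beta.GAN24.OneStepConstraintBlockPresentation` — binder row G-an2-4 ∕ (CONV-C), routes C-R6° («VALUES») × R7 («TWO CURRENCIES»), PART 186:
# THE BLOCK-FIBRED PRESENTATION OF THE ONE-STEP CARRIERS.  The gauge-fixed one-loop letter `𝒢 = flucCov(H, Q_ax)` (PARTs 177–184) lives on the fine bonds
# `Tor (fine (R·N) M) × Fin d`, its block propagator `P = Q_axK⁻¹Q_axᵀ` on the STACKED index `(coarse bonds) ⊕ T` (`T` = the axial tree bonds).  PART 144's volume-limit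
# engine wants carriers `Site × F` over ONE base torus with a FIXED finite fibre.  Both carriers are such, over the COARSE torus `Tor (fine N M)`: a fine bond is
# (block parent, (offset, direction)) — `ρ(y,(j,μ)) = (R·y + j, μ)` — and a stacked index is (parent, direction ⊕ tree offset) — `ε(y, inl μ) = inl (y,μ)`,
# `ε(y, inr (j,μ)) = inr (R·y + j, μ)`.  This file proves that `ρ`, `ε` are bijections compatible with the block parent ∕ the key, identifies integer readings
# (`R·ẑ + j = (R z + j)^`), and transports the lineage's algebra along them: the stacked constraint's presented entries, `P∘(ε,ε) = (Q_ax∘(ε,ρ))(K⁻¹∘(ρ,ρ))(Q_axᵀ∘(ρ,ε))`,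
# and the bordered-inverse formula `𝒢∘(ρ,ρ) = K⁻¹∘(ρ,ρ) − (K⁻¹Q_axᵀ∘(ρ,ε))(P∘(ε,ε))⁻¹(Q_axK⁻¹∘(ε,ρ))` (unit b2b-balaban-gan24-p3, gen 61; v1)

NOT IN PRINT; OUR PROOF ([folklore] bookkeeping BY NAME over NE2's `BalabanAveragedTowerModes` (`par_cpt_add_off`, `rem_cpt_add_off`, `cpt_par_add_off_rem`), an2's
`CompositionSingular.blocks_eq_of_reg` (the three blocks of the bordered inverse from the regularised reading), PART 105 `EffectiveFormLocalisation` (`blockProp_coercive_of_ub`,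
`isUnit_det_of_coercive(_fine)`, `transpose_reg`), PART 185 `VolumeLimitPairsRect` (`inv_submatrix_of_bijective`), Mathlib's `Matrix.submatrix` calculus (`submatrix_mul` along a bijective middle map);
[Balaban1984PropagatorsII] (2.121) p. 244, (2.152)–(2.157) pp. 249–250 LOCATE the objects; nothing printed is a hypothesis).
HONEST FRAMING (cell contract, verbatim): «discharging `BetaPertH` makes Bałaban's UV stability UNCONDITIONAL — a real constructive-QFT result; it is NOT the
continuum limit and NOT the Clay problem.»  HONEST DEPENDENCY (verbatim): «continuum YM on T⁴ ⇐ BetaPertH ∧ nine spine estimates (0/9 proved); BetaPertH ⇐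
(D1) ∧ (D4) ∧ CAP+tail; G-an2-4 gates asym, D1 and NE2/3/4.»

THE OBJECTS (no `def`; spelled inline): `ρ p = (cpt N R M p.1 + off N R M p.2.1, p.2.2)` on `Tor (fine N M) × ((Fin d → Fin R) × Fin d)`; the tree `T = {x ∣ rem_ν x = 0 (ν < x.2),
rem_{x.2} x + 1 < R}` and the tree offsets `Tr = {(j,μ) ∣ j_ν = 0 (ν < μ), j_μ + 1 < R}`; `ε p = Sum.elim (μ ↦ inl (p.1,μ)) (f ↦ inr ⟨ρ(p.1,f), tree_cpt_add_off⟩) p.2`;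
`Q_ax = fromRows (re QB N R M) E_T`, `K = H + Q_axᵀ(a•1)Q_ax`, `P = blockProp K Q_ax`.
WHAT THIS FILE PROVES (0 sorry, 0 `def`; `N, R ≥ 1`, every torus `M`, every `d`):
* §1 `rho_injective`, `rho_surjective`, **`rho_bijective`**, `par_rho` (`par ∘ ρ = Prod.fst`), **`cpt_castT_add_off`** (`cpt ẑ + off j = (R·z + j)^` — integer readings),
  `tstep_eq_castT` (`t·e_μ = (t e_μ)^`).
* §2 `tree_cpt_add_off` (`ρ(y, f) ∈ T` for `f ∈ Tr`), `eps_injective`, `eps_surjective`, **`eps_bijective`**, **`key_eps`** (`key ∘ ε = Prod.fst`).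
* §3 `fromRows_eps_inl` ∕ `fromRows_eps_inr` ∕ **`fromRows_eps_inr_rho`** (the presented entries of `Q_ax`: the averaging rows verbatim, the projection rows `[(y′,f′) = (y,f)]`),
  `abs_fromRows_le_one` (`|Q_ax(β,x)| ≤ 1`), `fromRows_eq_zero_of_one_lt_tdist` (support: `Q_ax(β,x) = 0` unless `tdist(key β, par x) ≤ 1`).
* §4 **`blockProp_submatrix_eps`** (`P∘(ε,ε) = (Q_ax∘(ε,ρ))·(K⁻¹∘(ρ,ρ))·(Q_ax∘(ε,ρ))ᵀ`-shape), **`inv_blockProp_submatrix_eps`** (`(P∘(ε,ε))⁻¹ = P⁻¹∘(ε,ε)`),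
  **`blocks_eq_of_ub`** (under `H` symmetric PSD, `a > 0`, `K` `γ`-coercive, the trial-form bound `hUB`: `𝒮 = P⁻¹ − a•1`, `ℋ = K⁻¹Q_axᵀP⁻¹`, `𝒢 = K⁻¹ − (K⁻¹Q_axᵀP⁻¹)Q_axK⁻¹`),
  **`flucCov_rho_rho_eq`** (`𝒢(ρr, ρr′) = (K⁻¹∘(ρ,ρ))(r,r′) − ((K⁻¹Q_axᵀ∘(ρ,ε))·(P∘(ε,ε))⁻¹·(Q_axK⁻¹∘(ε,ρ)))(r,r′)`).
WHAT IT IS NOT: no estimate and no limit here (PARTs 187 ff.).  SUPPLIER work; NEVER «G-an2-4 closed»; NOT (CONV-C), NOT D1, NOT `BetaPertH`, NOT continuum, NOT Clay.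
Records: `HOME/b2b-balaban-gan24-p3/gen61/README.md`.
-/

noncomputable section

open scoped BigOperators Matrix
open Finset Matrix

namespace Summit.QuantumFields.BalabanUV.Beta.GAN24.OneStepConstraintBlockPresentation

open Literature.MathematicalPhysics.QuantumFieldTheory.Balaban1983to89
open Literature.MathematicalPhysics.QuantumFieldTheory.Balaban1983to89.B5Prop11Plancherel (Tor fine)
open Literature.MathematicalPhysics.QuantumFieldTheory.Balaban1983to89.B5RealFields (reM)
open Literature.MathematicalPhysics.QuantumFieldTheory.Balaban1983to89.B5Block118 (tstep)
open Literature.MathematicalPhysics.QuantumFieldTheory.Balaban1983to89.B5G183RateTorus (cpt)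
open Literature.MathematicalPhysics.QuantumFieldTheory.Balaban1983to89.B5G183RateTorusW (off)
open Literature.MathematicalPhysics.QuantumFieldTheory.Balaban1983to89.Beta.VectorTails (castT)
open Literature.MathematicalPhysics.QuantumFieldTheory.Balaban1983to89.Beta.VectorTailsCov (tdist tdist_comm)
open Literature.MathematicalPhysics.QuantumFieldTheory.Balaban1983to89.Beta.Composition (blockProp)
open Literature.MathematicalPhysics.QuantumFieldTheory.Balaban1983to89.Beta.CompositionSingular (effForm minOp flucCov blocks_eq_of_reg)
open Summit.QuantumFields.BalabanUV.T4Continuum.BalabanLineAverage (QB)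
open Summit.QuantumFields.BalabanUV.T4Continuum.BalabanAveragedTowerModes (par rem par_cpt_add_off rem_cpt_add_off cpt_par_add_off_rem)
open Summit.QuantumFields.BalabanUV.Beta.GAN24.EffectiveFormLocalisation (blockProp_coercive_of_ub isUnit_det_of_coercive isUnit_det_of_coercive_fine transpose_reg)
open Summit.QuantumFields.BalabanUV.Beta.GAN24.OneStepConstraintAxialGauges (sum_abs_fromRows_row tdist_key_par_le_one)
open Summit.QuantumFields.BalabanUV.Beta.GAN24.VolumeLimitPairsRect (inv_submatrix_of_bijective)

variable {d : ℕ} (N R : ℕ) [NeZero N] [NeZero R] (M : Fin d → ℕ) [hM : ∀ μ, NeZero (M μ)]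

/-! ## §1 The fine presentation `ρ(y,(j,μ)) = (R·y + j, μ)` -/

section Rho

/-- `ρ` is injective (parents and offsets are recovered by `par`, `rem`). [folklore] -/
theorem rho_injective : Function.Injective (fun p : Tor (fine N M) × ((Fin d → Fin R) × Fin d) => ((cpt N R M p.1 + off N R M p.2.1, p.2.2) : Tor (fine (R * N) M) × Fin d)) := by
  rintro ⟨y, j, μ⟩ ⟨y', j', μ'⟩ h
  simp only [Prod.mk.injEq] at h
  obtain ⟨h1, h2⟩ := h
  have hy : y = y' := by
    have := congrArg (par N R M) h1
    rwa [par_cpt_add_off, par_cpt_add_off] at this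
  have hj : j = j' := by
    have := congrArg (rem N R M) h1
    rwa [rem_cpt_add_off, rem_cpt_add_off] at this
  rw [hy, hj, h2]

/-- `ρ` is surjective (`x = R·par x + rem x`). [folklore] -/
theorem rho_surjective : Function.Surjective (fun p : Tor (fine N M) × ((Fin d → Fin R) × Fin d) => ((cpt N R M p.1 + off N R M p.2.1, p.2.2) : Tor (fine (R * N) M) × Fin d)) :=
  fun x => ⟨(par N R M x.1, (rem N R M x.1, x.2)), Prod.ext (cpt_par_add_off_rem N R M x.1) rfl⟩

/-- **`rho_bijective`** — fine bonds ARE (block parent, (offset, direction)). [folklore] -/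
theorem rho_bijective : Function.Bijective (fun p : Tor (fine N M) × ((Fin d → Fin R) × Fin d) => ((cpt N R M p.1 + off N R M p.2.1, p.2.2) : Tor (fine (R * N) M) × Fin d)) :=
  ⟨rho_injective N R M, rho_surjective N R M⟩

/-- `par (ρ(y,f)).1 = y`. [folklore] -/
theorem par_rho (p : Tor (fine N M) × ((Fin d → Fin R) × Fin d)) : par N R M (cpt N R M p.1 + off N R M p.2.1) = p.1 :=
  par_cpt_add_off N R M p.1 p.2.1

omit [NeZero R] in
/-- **`cpt_castT_add_off` — INTEGER READINGS UNDER `ρ`**: `cpt ẑ + off j = (R·z + j)^` (the fine reading of the block reading `z` at offset `j`). [folklore] -/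
theorem cpt_castT_add_off (z : Fin d → ℤ) (j : Fin d → Fin R) :
    cpt N R M (castT (fine N M) z) + off N R M j = castT (fine (R * N) M) (fun ν => (R : ℤ) * z ν + ((j ν : ℕ) : ℤ)) := by
  funext ν
  have hval : (((z ν : ZMod (fine N M ν)).val : ℤ)) = z ν % (fine N M ν : ℕ) := ZMod.val_intCast (z ν)
  have key : (((R * (z ν : ZMod (fine N M ν)).val : ℕ) : ℤ) : ZMod (fine (R * N) M ν)) = ((((R : ℤ) * z ν : ℤ)) : ZMod (fine (R * N) M ν)) := by
    rw [ZMod.intCast_eq_intCast_iff_dvd_sub]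
    refine ⟨z ν / (fine N M ν : ℕ), ?_⟩
    have h := Int.emod_def (z ν) (fine N M ν : ℕ)
    push_cast
    rw [hval, h]
    simp only [fine, Nat.cast_mul]
    ring
  simp only [Pi.add_apply, cpt, off, castT]
  rw [← Int.cast_natCast (R := ZMod (fine (R * N) M ν)) (R * _), key, ← Int.cast_natCast (R := ZMod (fine (R * N) M ν)) (j ν : ℕ)]
  push_cast
  ring

omit hM in
/-- `t·e_μ = (t e_μ)^`: the own-direction step is the reading of the integer vector `t e_μ`. [folklore] -/
theorem tstep_eq_castT (Nf : Fin d → ℕ) (μ : Fin d) (t : ℕ) : tstep Nf μ t = castT Nf (fun ν => if ν = μ then (t : ℤ) else 0) := by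
  funext ν
  by_cases h : ν = μ
  · simp [tstep, castT, h]
  · simp [tstep, castT, h]

end Rho

/-! ## §2 The stacked presentation `ε(y, inl μ) = inl (y,μ)`, `ε(y, inr (j,μ)) = inr (R·y + j, μ)` -/

section Eps

/-- a tree offset planted in any block is a tree bond: `ρ(y,f) ∈ T` for `f ∈ Tr` (`rem (R·y + j) = j`). [folklore] -/
theorem tree_cpt_add_off (y : Tor (fine N M)) (f : {f : (Fin d → Fin R) × Fin d // (∀ ν, ν < f.2 → ((f.1 ν : ℕ)) = 0) ∧ ((f.1 f.2 : ℕ)) + 1 < R}) :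
    (∀ ν, ν < f.1.2 → ((rem N R M (cpt N R M y + off N R M f.1.1) ν : ℕ)) = 0) ∧ ((rem N R M (cpt N R M y + off N R M f.1.1) f.1.2 : ℕ)) + 1 < R := by
  rw [rem_cpt_add_off]; exact f.2

/-- `ε` is injective. [folklore] -/
theorem eps_injective : Function.Injective (fun p : Tor (fine N M) × (Fin d ⊕ {f : (Fin d → Fin R) × Fin d // (∀ ν, ν < f.2 → ((f.1 ν : ℕ)) = 0) ∧ ((f.1 f.2 : ℕ)) + 1 < R}) =>
      Sum.elim (fun μ : Fin d => (Sum.inl (p.1, μ) : (Tor (fine N M) × Fin d) ⊕ {x : Tor (fine (R * N) M) × Fin d // (∀ ν, ν < x.2 → ((rem N R M x.1 ν : ℕ)) = 0) ∧ ((rem N R M x.1 x.2 : ℕ)) + 1 < R}))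
        (fun f => Sum.inr ⟨(cpt N R M p.1 + off N R M f.1.1, f.1.2), tree_cpt_add_off N R M p.1 f⟩) p.2) := by
  rintro ⟨y, g⟩ ⟨y', g'⟩ h
  rcases g with μ | f <;> rcases g' with μ' | f'
  · simp only [Sum.elim_inl, Sum.inl.injEq, Prod.mk.injEq] at h
    rw [h.1, h.2]
  · simp only [Sum.elim_inl, Sum.elim_inr, reduceCtorEq] at h
  · simp only [Sum.elim_inl, Sum.elim_inr, reduceCtorEq] at h
  · simp only [Sum.elim_inr, Sum.inr.injEq, Subtype.mk.injEq] at h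
    have h' := rho_injective N R M (a₁ := (y, f.1)) (a₂ := (y', f'.1)) h
    simp only [Prod.mk.injEq] at h'
    rw [h'.1, show f = f' from Subtype.ext h'.2]

/-- `ε` is surjective (`inl (y,μ) = ε(y, inl μ)`; a tree bond `x` is `ε(par x, inr (rem x, x.2))`). [folklore] -/
theorem eps_surjective : Function.Surjective (fun p : Tor (fine N M) × (Fin d ⊕ {f : (Fin d → Fin R) × Fin d // (∀ ν, ν < f.2 → ((f.1 ν : ℕ)) = 0) ∧ ((f.1 f.2 : ℕ)) + 1 < R}) =>
      Sum.elim (fun μ : Fin d => (Sum.inl (p.1, μ) : (Tor (fine N M) × Fin d) ⊕ {x : Tor (fine (R * N) M) × Fin d // (∀ ν, ν < x.2 → ((rem N R M x.1 ν : ℕ)) = 0) ∧ ((rem N R M x.1 x.2 : ℕ)) + 1 < R}))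
        (fun f => Sum.inr ⟨(cpt N R M p.1 + off N R M f.1.1, f.1.2), tree_cpt_add_off N R M p.1 f⟩) p.2) := by
  intro β
  rcases β with ⟨y, μ⟩ | ⟨x, hx⟩
  · exact ⟨(y, Sum.inl μ), rfl⟩
  · refine ⟨(par N R M x.1, Sum.inr ⟨(rem N R M x.1, x.2), hx⟩), ?_⟩
    simp only [Sum.elim_inr, Sum.inr.injEq]
    exact Subtype.ext (Prod.ext (cpt_par_add_off_rem N R M x.1) rfl)

/-- **`eps_bijective`** — the stacked index (coarse bonds) ⊕ T IS (block parent, direction ⊕ tree offset). [folklore] -/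
theorem eps_bijective : Function.Bijective (fun p : Tor (fine N M) × (Fin d ⊕ {f : (Fin d → Fin R) × Fin d // (∀ ν, ν < f.2 → ((f.1 ν : ℕ)) = 0) ∧ ((f.1 f.2 : ℕ)) + 1 < R}) =>
      Sum.elim (fun μ : Fin d => (Sum.inl (p.1, μ) : (Tor (fine N M) × Fin d) ⊕ {x : Tor (fine (R * N) M) × Fin d // (∀ ν, ν < x.2 → ((rem N R M x.1 ν : ℕ)) = 0) ∧ ((rem N R M x.1 x.2 : ℕ)) + 1 < R}))
        (fun f => Sum.inr ⟨(cpt N R M p.1 + off N R M f.1.1, f.1.2), tree_cpt_add_off N R M p.1 f⟩) p.2) :=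
  ⟨eps_injective N R M, eps_surjective N R M⟩

/-- **`key_eps`** — the coarse key of a presented stacked index is its parent coordinate: `key (ε p) = p.1`. [folklore] -/
theorem key_eps (p : Tor (fine N M) × (Fin d ⊕ {f : (Fin d → Fin R) × Fin d // (∀ ν, ν < f.2 → ((f.1 ν : ℕ)) = 0) ∧ ((f.1 f.2 : ℕ)) + 1 < R})) :
    Sum.elim (fun b : Tor (fine N M) × Fin d => b.1)
        (fun t : {x : Tor (fine (R * N) M) × Fin d // (∀ ν, ν < x.2 → ((rem N R M x.1 ν : ℕ)) = 0) ∧ ((rem N R M x.1 x.2 : ℕ)) + 1 < R} =>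
          par N R M ((Function.Embedding.subtype (fun x : Tor (fine (R * N) M) × Fin d => (∀ ν, ν < x.2 → ((rem N R M x.1 ν : ℕ)) = 0) ∧ ((rem N R M x.1 x.2 : ℕ)) + 1 < R)) t).1)
      (Sum.elim (fun μ : Fin d => (Sum.inl (p.1, μ) : (Tor (fine N M) × Fin d) ⊕ {x : Tor (fine (R * N) M) × Fin d // (∀ ν, ν < x.2 → ((rem N R M x.1 ν : ℕ)) = 0) ∧ ((rem N R M x.1 x.2 : ℕ)) + 1 < R}))
        (fun f => Sum.inr ⟨(cpt N R M p.1 + off N R M f.1.1, f.1.2), tree_cpt_add_off N R M p.1 f⟩) p.2) = p.1 := by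
  obtain ⟨y, g⟩ := p
  rcases g with μ | f
  · rfl
  · simp only [Sum.elim_inr, Function.Embedding.coe_subtype]
    exact par_cpt_add_off N R M y f.1.1

end Eps

/-! ## §3 The presented entries of the stacked constraint `Q_ax = fromRows (re QB) E_T` -/

section Entries

/-- an averaging row, presented: `Q_ax(ε(y, inl μ), x) = re QB((y,μ), x)`. [folklore] -/
theorem fromRows_eps_inl (y : Tor (fine N M)) (μ : Fin d) (x : Tor (fine (R * N) M) × Fin d) :
    Matrix.fromRows (reM (QB N R M))
        (fun (t : {x : Tor (fine (R * N) M) × Fin d // (∀ ν, ν < x.2 → ((rem N R M x.1 ν : ℕ)) = 0) ∧ ((rem N R M x.1 x.2 : ℕ)) + 1 < R}) (x : Tor (fine (R * N) M) × Fin d) =>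
          if x = (Function.Embedding.subtype (fun x : Tor (fine (R * N) M) × Fin d => (∀ ν, ν < x.2 → ((rem N R M x.1 ν : ℕ)) = 0) ∧ ((rem N R M x.1 x.2 : ℕ)) + 1 < R)) t then (1 : ℝ) else 0)
        (Sum.elim (fun μ : Fin d => (Sum.inl (y, μ) : (Tor (fine N M) × Fin d) ⊕ {x : Tor (fine (R * N) M) × Fin d // (∀ ν, ν < x.2 → ((rem N R M x.1 ν : ℕ)) = 0) ∧ ((rem N R M x.1 x.2 : ℕ)) + 1 < R}))
          (fun f : {f : (Fin d → Fin R) × Fin d // (∀ ν, ν < f.2 → ((f.1 ν : ℕ)) = 0) ∧ ((f.1 f.2 : ℕ)) + 1 < R} =>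
            Sum.inr ⟨(cpt N R M y + off N R M f.1.1, f.1.2), tree_cpt_add_off N R M y f⟩) (Sum.inl μ)) x
      = reM (QB N R M) (y, μ) x := rfl

/-- a projection row, presented: `Q_ax(ε(y, inr f), x) = [x = ρ(y,f)]`. [folklore] -/
theorem fromRows_eps_inr (y : Tor (fine N M)) (f : {f : (Fin d → Fin R) × Fin d // (∀ ν, ν < f.2 → ((f.1 ν : ℕ)) = 0) ∧ ((f.1 f.2 : ℕ)) + 1 < R}) (x : Tor (fine (R * N) M) × Fin d) :
    Matrix.fromRows (reM (QB N R M))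
        (fun (t : {x : Tor (fine (R * N) M) × Fin d // (∀ ν, ν < x.2 → ((rem N R M x.1 ν : ℕ)) = 0) ∧ ((rem N R M x.1 x.2 : ℕ)) + 1 < R}) (x : Tor (fine (R * N) M) × Fin d) =>
          if x = (Function.Embedding.subtype (fun x : Tor (fine (R * N) M) × Fin d => (∀ ν, ν < x.2 → ((rem N R M x.1 ν : ℕ)) = 0) ∧ ((rem N R M x.1 x.2 : ℕ)) + 1 < R)) t then (1 : ℝ) else 0)
        (Sum.elim (fun μ : Fin d => (Sum.inl (y, μ) : (Tor (fine N M) × Fin d) ⊕ {x : Tor (fine (R * N) M) × Fin d // (∀ ν, ν < x.2 → ((rem N R M x.1 ν : ℕ)) = 0) ∧ ((rem N R M x.1 x.2 : ℕ)) + 1 < R}))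
          (fun f : {f : (Fin d → Fin R) × Fin d // (∀ ν, ν < f.2 → ((f.1 ν : ℕ)) = 0) ∧ ((f.1 f.2 : ℕ)) + 1 < R} =>
            Sum.inr ⟨(cpt N R M y + off N R M f.1.1, f.1.2), tree_cpt_add_off N R M y f⟩) (Sum.inr f)) x
      = if x = (cpt N R M y + off N R M f.1.1, f.1.2) then (1 : ℝ) else 0 := rfl

/-- **`fromRows_eps_inr_rho`** — a projection row at a presented fine bond: `Q_ax(ε(y, inr f), ρ(y′,f′)) = [(y′,f′) = (y,f)]` (eventually constant at integer readings). [folklore] -/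
theorem fromRows_eps_inr_rho (y : Tor (fine N M)) (f : {f : (Fin d → Fin R) × Fin d // (∀ ν, ν < f.2 → ((f.1 ν : ℕ)) = 0) ∧ ((f.1 f.2 : ℕ)) + 1 < R})
    (p' : Tor (fine N M) × ((Fin d → Fin R) × Fin d)) :
    Matrix.fromRows (reM (QB N R M))
        (fun (t : {x : Tor (fine (R * N) M) × Fin d // (∀ ν, ν < x.2 → ((rem N R M x.1 ν : ℕ)) = 0) ∧ ((rem N R M x.1 x.2 : ℕ)) + 1 < R}) (x : Tor (fine (R * N) M) × Fin d) =>
          if x = (Function.Embedding.subtype (fun x : Tor (fine (R * N) M) × Fin d => (∀ ν, ν < x.2 → ((rem N R M x.1 ν : ℕ)) = 0) ∧ ((rem N R M x.1 x.2 : ℕ)) + 1 < R)) t then (1 : ℝ) else 0)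
        (Sum.elim (fun μ : Fin d => (Sum.inl (y, μ) : (Tor (fine N M) × Fin d) ⊕ {x : Tor (fine (R * N) M) × Fin d // (∀ ν, ν < x.2 → ((rem N R M x.1 ν : ℕ)) = 0) ∧ ((rem N R M x.1 x.2 : ℕ)) + 1 < R}))
          (fun f : {f : (Fin d → Fin R) × Fin d // (∀ ν, ν < f.2 → ((f.1 ν : ℕ)) = 0) ∧ ((f.1 f.2 : ℕ)) + 1 < R} =>
            Sum.inr ⟨(cpt N R M y + off N R M f.1.1, f.1.2), tree_cpt_add_off N R M y f⟩) (Sum.inr f)) (cpt N R M p'.1 + off N R M p'.2.1, p'.2.2)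
      = if p' = (y, f.1) then (1 : ℝ) else 0 := by
  rw [fromRows_eps_inr]
  have hiff : ((cpt N R M p'.1 + off N R M p'.2.1, p'.2.2) : Tor (fine (R * N) M) × Fin d) = (cpt N R M y + off N R M f.1.1, f.1.2) ↔ p' = (y, f.1) := by
    constructor
    · intro h
      exact rho_injective N R M (a₁ := p') (a₂ := (y, f.1)) h
    · rintro rfl; rfl
  simp only [hiff]

variable {T : Type*} [Fintype T] [DecidableEq T] (ι : T ↪ Tor (fine (R * N) M) × Fin d)

omit [Fintype T] [DecidableEq T] in
/-- `|Q_ax(β,x)| ≤ 1` (a term of a row of mass `≤ 1`, PART 180 `sum_abs_fromRows_row`). [folklore] -/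
theorem abs_fromRows_le_one (b : (Tor (fine N M) × Fin d) ⊕ T) (x : Tor (fine (R * N) M) × Fin d) :
    |Matrix.fromRows (reM (QB N R M)) (fun (t : T) (x : Tor (fine (R * N) M) × Fin d) => if x = ι t then (1 : ℝ) else 0) b x| ≤ 1 :=
  (Finset.single_le_sum (f := fun x => |Matrix.fromRows (reM (QB N R M)) (fun (t : T) (x : Tor (fine (R * N) M) × Fin d) => if x = ι t then (1 : ℝ) else 0) b x|)
    (fun _ _ => abs_nonneg _) (Finset.mem_univ x)).trans (sum_abs_fromRows_row N R M ι b)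

omit [Fintype T] [DecidableEq T] in
/-- support ⟹ decay: `|Q_ax(β,x)| ≤ e·e^{−tdist(key β, par x)}` (the entry vanishes unless `tdist(key β, par x) ≤ 1`, PART 180 `tdist_key_par_le_one`). [folklore] -/
theorem abs_fromRows_le_exp (b : (Tor (fine N M) × Fin d) ⊕ T) (x : Tor (fine (R * N) M) × Fin d) :
    |Matrix.fromRows (reM (QB N R M)) (fun (t : T) (x : Tor (fine (R * N) M) × Fin d) => if x = ι t then (1 : ℝ) else 0) b x|
      ≤ Real.exp 1 * Real.exp (-(1 * (tdist (Sum.elim (fun b : Tor (fine N M) × Fin d => b.1) (fun t : T => par N R M (ι t).1) b) (par N R M x.1) : ℝ))) := by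
  by_cases h : Matrix.fromRows (reM (QB N R M)) (fun (t : T) (x : Tor (fine (R * N) M) × Fin d) => if x = ι t then (1 : ℝ) else 0) b x = 0
  · rw [h, abs_zero]; positivity
  · have h1 := tdist_key_par_le_one N R M ι h
    have h2 : (tdist (Sum.elim (fun b : Tor (fine N M) × Fin d => b.1) (fun t : T => par N R M (ι t).1) b) (par N R M x.1) : ℝ) ≤ 1 := by exact_mod_cast h1
    calc _ ≤ (1 : ℝ) := abs_fromRows_le_one N R M ι b x
      _ = Real.exp 1 * Real.exp (-1) := by rw [← Real.exp_add]; norm_num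
      _ ≤ Real.exp 1 * Real.exp (-(1 * (tdist (Sum.elim (fun b : Tor (fine N M) × Fin d => b.1) (fun t : T => par N R M (ι t).1) b) (par N R M x.1) : ℝ))) := by
          gcongr; linarith

end Entries

/-! ## §4 The bordered inverse along the presentations -/

section Algebra

variable {c ν A B : Type*} [Fintype c] [Fintype ν] [Fintype A] [Fintype B] [DecidableEq c] [DecidableEq ν] [DecidableEq A] [DecidableEq B]

omit [Fintype A] [Fintype B] [DecidableEq A] [DecidableEq B] in
/-- **`blocks_eq_of_ub` — THE THREE BLOCKS OF THE BORDERED INVERSE FROM THE REGULARISED READING, under the lineage's standing hypotheses** (`H` symmetric with nonnegative form,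
`a > 0`, `K = H + Qᵀ(a•1)Q` `γ`-coercive, the trial-form bound `hUB`; then `K` and `P = QK⁻¹Qᵀ` are invertible by PART 105 and an2's `blocks_eq_of_reg` applies):
`𝒮 = P⁻¹ − a•1`, `ℋ = K⁻¹QᵀP⁻¹`, `𝒢 = K⁻¹ − (K⁻¹QᵀP⁻¹)QK⁻¹`. [folklore] -/
theorem blocks_eq_of_ub {H : Matrix ν ν ℝ} {Q : Matrix c ν ℝ} {a : ℝ} (hH : Hᵀ = H) (hpsd : ∀ z : ν → ℝ, 0 ≤ z ⬝ᵥ (H *ᵥ z)) (ha : 0 < a) {γ : ℝ} (hγ : 0 < γ)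
    (hK : QGQInverse.Coercive (H + Qᵀ * (a • (1 : Matrix c c ℝ)) * Q) γ) {Λ : ℝ} (hΛ : 0 ≤ Λ)
    (hUB : ∀ B : c → ℝ, ∃ u : ν → ℝ, Q *ᵥ u = B ∧ u ⬝ᵥ (H *ᵥ u) ≤ Λ * (B ⬝ᵥ B)) :
    effForm H Q = (blockProp (H + Qᵀ * (a • (1 : Matrix c c ℝ)) * Q) Q)⁻¹ - a • (1 : Matrix c c ℝ) ∧
    minOp H Q = (H + Qᵀ * (a • (1 : Matrix c c ℝ)) * Q)⁻¹ * Qᵀ * (blockProp (H + Qᵀ * (a • (1 : Matrix c c ℝ)) * Q) Q)⁻¹ ∧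
    flucCov H Q = (H + Qᵀ * (a • (1 : Matrix c c ℝ)) * Q)⁻¹ -
      (H + Qᵀ * (a • (1 : Matrix c c ℝ)) * Q)⁻¹ * Qᵀ * (blockProp (H + Qᵀ * (a • (1 : Matrix c c ℝ)) * Q) Q)⁻¹ * Q * (H + Qᵀ * (a • (1 : Matrix c c ℝ)) * Q)⁻¹ := by
  have hΛa : 0 < Λ + a := by linarith
  have hPco := blockProp_coercive_of_ub hH hpsd ha hγ hK hΛ hUB
  have hKdet : IsUnit (H + Qᵀ * (a • (1 : Matrix c c ℝ)) * Q).det := isUnit_det_of_coercive_fine hγ hK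
  have hPdet : IsUnit (blockProp (H + Qᵀ * (a • (1 : Matrix c c ℝ)) * Q) Q).det := isUnit_det_of_coercive (inv_pos.mpr hΛa) hPco
  obtain ⟨hS, hM', hC⟩ := blocks_eq_of_reg H Q (a • (1 : Matrix c c ℝ)) hKdet hPdet
  exact ⟨hS, hM', by rw [hC]; rfl⟩

omit [Fintype c] [Fintype B] [DecidableEq c] [DecidableEq A] [DecidableEq B] in
/-- **`blockProp_submatrix_eps`** — the block propagator along the presentations: `P∘(ε,ε) = (Q∘(ε,ρ))·(K⁻¹∘(ρ,ρ))·(Q∘(ε,ρ))ᵀ` for a bijection `ρ` of the fine index and any map `ε`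
of the coarse index. [folklore] -/
theorem blockProp_submatrix_eps (K : Matrix ν ν ℝ) (Q : Matrix c ν ℝ) {ρ : A → ν} (hρ : Function.Bijective ρ) (ε : B → c) :
    (blockProp K Q).submatrix ε ε = Q.submatrix ε ρ * K⁻¹.submatrix ρ ρ * (Q.submatrix ε ρ)ᵀ := by
  unfold blockProp
  rw [Matrix.submatrix_mul (Q * K⁻¹) Qᵀ ε ρ ε hρ, Matrix.submatrix_mul Q K⁻¹ ε ρ ρ hρ, Matrix.transpose_submatrix]

omit [Fintype A] [DecidableEq A] in
/-- `(P∘(ε,ε))⁻¹ = P⁻¹∘(ε,ε)` for a bijection `ε`. [folklore] -/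
theorem inv_blockProp_submatrix_eps (K : Matrix ν ν ℝ) (Q : Matrix c ν ℝ) {ε : B → c} (hε : Function.Bijective ε) :
    ((blockProp K Q).submatrix ε ε)⁻¹ = (blockProp K Q)⁻¹.submatrix ε ε :=
  inv_submatrix_of_bijective hε _

omit [Fintype A] [DecidableEq A] in
/-- **`flucCov_rho_rho_eq` — THE FLUCTUATION COVARIANCE ALONG THE PRESENTATIONS**: under the hypotheses of `blocks_eq_of_ub`, for any map `ρ` into the fine index and a bijection
`ε` of the coarse index, `𝒢(ρr, ρr′) = (K⁻¹∘(ρ,ρ))(r,r′) − ((K⁻¹Qᵀ∘(ρ,ε))·(P∘(ε,ε))⁻¹·(QK⁻¹∘(ε,ρ)))(r,r′)` — every factor a matrix on a presented carrier. [folklore] -/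
theorem flucCov_rho_rho_eq {H : Matrix ν ν ℝ} {Q : Matrix c ν ℝ} {a : ℝ} (hH : Hᵀ = H) (hpsd : ∀ z : ν → ℝ, 0 ≤ z ⬝ᵥ (H *ᵥ z)) (ha : 0 < a) {γ : ℝ} (hγ : 0 < γ)
    (hK : QGQInverse.Coercive (H + Qᵀ * (a • (1 : Matrix c c ℝ)) * Q) γ) {Λ : ℝ} (hΛ : 0 ≤ Λ)
    (hUB : ∀ B : c → ℝ, ∃ u : ν → ℝ, Q *ᵥ u = B ∧ u ⬝ᵥ (H *ᵥ u) ≤ Λ * (B ⬝ᵥ B))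
    (ρ : A → ν) {ε : B → c} (hε : Function.Bijective ε) (r r' : A) :
    flucCov H Q (ρ r) (ρ r') = ((H + Qᵀ * (a • (1 : Matrix c c ℝ)) * Q)⁻¹.submatrix ρ ρ) r r' -
      ((((H + Qᵀ * (a • (1 : Matrix c c ℝ)) * Q)⁻¹ * Qᵀ).submatrix ρ ε) * ((blockProp (H + Qᵀ * (a • (1 : Matrix c c ℝ)) * Q) Q).submatrix ε ε)⁻¹ *
        ((Q * (H + Qᵀ * (a • (1 : Matrix c c ℝ)) * Q)⁻¹).submatrix ε ρ)) r r' := by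
  obtain ⟨-, -, hC⟩ := blocks_eq_of_ub hH hpsd ha hγ hK hΛ hUB
  set K : Matrix ν ν ℝ := H + Qᵀ * (a • (1 : Matrix c c ℝ)) * Q with hKdef
  rw [hC, Matrix.sub_apply, inv_blockProp_submatrix_eps K Q hε]
  congr 1
  have e : K⁻¹ * Qᵀ * (blockProp K Q)⁻¹ * Q * K⁻¹ = (K⁻¹ * Qᵀ * (blockProp K Q)⁻¹) * (Q * K⁻¹) := by
    simp only [Matrix.mul_assoc]
  rw [show (K⁻¹ * Qᵀ * (blockProp K Q)⁻¹ * Q * K⁻¹) (ρ r) (ρ r') = ((K⁻¹ * Qᵀ * (blockProp K Q)⁻¹ * Q * K⁻¹).submatrix ρ ρ) r r' from rfl, e,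
    Matrix.submatrix_mul (K⁻¹ * Qᵀ * (blockProp K Q)⁻¹) (Q * K⁻¹) ρ ε ρ hε, Matrix.submatrix_mul (K⁻¹ * Qᵀ) (blockProp K Q)⁻¹ ρ ε ε hε]

end Algebra

end Summit.QuantumFields.BalabanUV.Beta.GAN24.OneStepConstraintBlockPresentation

end
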